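import Summits.BirchSwinnertonDyer.BirchSwinnertonDyer.Theorems.ManinLocalTwoThreeNegOneTwistExitsWild
import Summits.BirchSwinnertonDyer.BirchSwinnertonDyer.Theorems.ManinLocalTwoThreeConductorExponentThreeAtTwo
import Literature.NumberTheory.EllipticCurves.NeronComponentIndexTypeIIIProofs
import Literature.NumberTheory.EllipticCurves.NeronComponentIndexTypeIIIstarProofs
import Literature.NumberTheory.EllipticCurves.NeronComponentIndexProofs
import Literature.NumberTheory.EllipticCurves.KodairaDiscriminantValuesTwoProofs
import Literature.NumberTheory.DiophantineGeometry.TateAlgorithmIstarSuccNormalFormProofs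
import HarnessLib

/-!
# S-an-60 local form: `f₂(W) = 3 ⟹ f₂(W ⊗ χ₋₄) = 4` (Barrios et al. 2025 Thm. 5.1, rows III, I₁*, III*, II*, `d ≡ 3 (mod 4)`)
# (route `ManinLocalTwoThree`, crux C2 `ManinOddAtFour` stmt-BirchSwinnertonDyer-22967; an's node `NegOneTwistConductorTwoMul`
# «8 ∥ N ⟹ N(W ⊗ χ₋₄) = 2·N(W)», the print input of the reduction C2 ⟸ C2|_{16 ∣ N}; cell bsd-f2-manin, p2 gen 13)

The global assembly, exactly as in this seat's S-an-58 file (`ManinLocalTwoThreeNegOneTwistConductorAtTwo`, §4): `f₂(W) = 3` gives, on the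
integral minimal model `V₀` over `ℤ₂`, one of `III/ord Δ = 4`, `I₁*/8`, `III*/10`, `II*/11` (`kodairaSymbolAt_of_conductorExponent_eq_three_two`);
the tree's normal forms (`LocalIndex.exists_smul_of_kodairaSymbolOfMinimal_eq_III/_IIIstar/_IIstar`, `exists_smul_of_kodairaSymbolOfMinimal_eq_Istar_succ`)
with the unit witnesses forced by the value of `ord Δ` (`addVal_Δ_toNat_of_step4/9/10`, and `ord Δ ≥ 10` on the `I₁*`-form with `8 ∣ a₃`);
the `χ₋₄`-twist of each form is an explicit `ℤ₂`-model (§1) on which Tate's algorithm exits at `II`, `I₀*`, `I₂*`, `I₃*`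
(`ManinLocalTwoThreeNegOneTwistExitsWild`), with the same `ord Δ`; Ogg's formula (`conductorExponent_negTwist_of_exitModel`) gives
`f₂′ = 4 + 1 − 1 = 8 + 1 − 5 = 10 + 1 − 7 = 11 + 1 − 8 = 4`.

HONEST FRAMING: a local theorem in print, kernel-checked for `d = −1`; it discharges the print input S-an-60 of an's reduction of C2 to its
`16 ∣ N` stratum.  Nothing about BSD or Manin's conjecture is proved; C2 OPEN.
[cite: BarriosEtAl2025, Thm. 5.1 (arXiv:2501.03209 pp. 15–16), rows III / I₁* / III* / II*, column (f, f^d) = (3, 4)]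
[cite: SilvermanATAEC1994, IV.9.4 and IV.11.1]
-/

set_option autoImplicit false
-- lint-debt: the directory name repeats the summit name (sibling precedent `ManinLocalTwoThreeNegOneTwistConductorAtTwo.lean`)
set_option linter.dupNamespace false

noncomputable section

open scoped Classical
open Polynomial IsLocalRing WeierstrassCurve
open IsDiscreteValuationRing hiding maximalIdeal
open Literature.NumberTheory.DiophantineGeometry Literature.NumberTheory.DiophantineGeometry.TateAlgorithm
  Literature.NumberTheory.DiophantineGeometry.TateAlgorithm.CharTwo Literature.NumberTheory.EllipticCurves

namespace Summit.BirchSwinnertonDyer.BirchSwinnertonDyer.Theorems.ManinLocalTwoThree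

/-! ## §1 The `χ₋₄`-twists of the four normal forms, read over `ℚ₂` -/

/-- Twist of the `III`-form `[2α, 2β, 2γ, 2q, 4r₁]`: `[0, −(α² + 2β), 0, 2(q + αγ), −(γ² + 4r₁)]`. [cite: SilvermanAEC2009, X.2 Prop. 2.4] -/
theorem quadraticTwist_negOne_map_of_IIIForm (N : WeierstrassCurve ℤ_[2]) {α β γ q r₁ : ℤ_[2]}
    (h₁ : N.a₁ = 2 * α) (h₂ : N.a₂ = 2 * β) (h₃ : N.a₃ = 2 * γ) (h₄ : N.a₄ = 2 * q) (h₆ : N.a₆ = 4 * r₁) :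
    (N.map (algebraMap ℤ_[2] ℚ_[2])).quadraticTwist (-1) =
      (⟨0, -(α ^ 2 + 2 * β), 0, 2 * (q + α * γ), -(γ ^ 2 + 4 * r₁)⟩ : WeierstrassCurve ℤ_[2]).map (algebraMap ℤ_[2] ℚ_[2]) := by
  obtain ⟨a₁, a₂, a₃, a₄, a₆⟩ := N
  simp only at h₁ h₂ h₃ h₄ h₆
  subst h₁ h₂ h₃ h₄ h₆
  have c2 : ((2 : ℤ_[2]) : ℚ_[2]) = 2 := map_ofNat PadicInt.Coe.ringHom 2
  have c4 : ((4 : ℤ_[2]) : ℚ_[2]) = 4 := map_ofNat PadicInt.Coe.ringHom 4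
  ext <;> simp [WeierstrassCurve.quadraticTwist, WeierstrassCurve.map, WeierstrassCurve.b₂, WeierstrassCurve.b₄,
    WeierstrassCurve.b₆, c2, c4] <;> ring

/-- Twist of the `I₁*`-form `[2α, 2β, 4γ, 8q, 16r]`: `[0, −(α² + 2β), 0, 8q + 4αγ, −(4γ² + 16r)]`. [cite: SilvermanAEC2009, X.2 Prop. 2.4] -/
theorem quadraticTwist_negOne_map_of_IstarOneForm (N : WeierstrassCurve ℤ_[2]) {α β γ q r : ℤ_[2]}
    (h₁ : N.a₁ = 2 * α) (h₂ : N.a₂ = 2 * β) (h₃ : N.a₃ = 4 * γ) (h₄ : N.a₄ = 8 * q) (h₆ : N.a₆ = 16 * r) :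
    (N.map (algebraMap ℤ_[2] ℚ_[2])).quadraticTwist (-1) =
      (⟨0, -(α ^ 2 + 2 * β), 0, 8 * q + 4 * α * γ, -(4 * γ ^ 2 + 16 * r)⟩ : WeierstrassCurve ℤ_[2]).map
        (algebraMap ℤ_[2] ℚ_[2]) := by
  obtain ⟨a₁, a₂, a₃, a₄, a₆⟩ := N
  simp only at h₁ h₂ h₃ h₄ h₆
  subst h₁ h₂ h₃ h₄ h₆
  have c2 : ((2 : ℤ_[2]) : ℚ_[2]) = 2 := map_ofNat PadicInt.Coe.ringHom 2
  have c4 : ((4 : ℤ_[2]) : ℚ_[2]) = 4 := map_ofNat PadicInt.Coe.ringHom 4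
  have c8 : ((8 : ℤ_[2]) : ℚ_[2]) = 8 := map_ofNat PadicInt.Coe.ringHom 8
  have c16 : ((16 : ℤ_[2]) : ℚ_[2]) = 16 := map_ofNat PadicInt.Coe.ringHom 16
  ext <;> simp [WeierstrassCurve.quadraticTwist, WeierstrassCurve.map, WeierstrassCurve.b₂, WeierstrassCurve.b₄,
    WeierstrassCurve.b₆, c2, c4, c8, c16] <;> ring

/-- Twist of the `III*`-form `[2α, 4p, 8γ, 8q, 32r]`: `[0, −(α² + 4p), 0, 8(q + αγ), −16(γ² + 2r)]`. [cite: SilvermanAEC2009, X.2 Prop. 2.4] -/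
theorem quadraticTwist_negOne_map_of_IIIstarForm (N : WeierstrassCurve ℤ_[2]) {α p γ q r : ℤ_[2]}
    (h₁ : N.a₁ = 2 * α) (h₂ : N.a₂ = 4 * p) (h₃ : N.a₃ = 8 * γ) (h₄ : N.a₄ = 8 * q) (h₆ : N.a₆ = 32 * r) :
    (N.map (algebraMap ℤ_[2] ℚ_[2])).quadraticTwist (-1) =
      (⟨0, -(α ^ 2 + 4 * p), 0, 8 * (q + α * γ), -(16 * (γ ^ 2 + 2 * r))⟩ : WeierstrassCurve ℤ_[2]).map
        (algebraMap ℤ_[2] ℚ_[2]) := by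
  obtain ⟨a₁, a₂, a₃, a₄, a₆⟩ := N
  simp only at h₁ h₂ h₃ h₄ h₆
  subst h₁ h₂ h₃ h₄ h₆
  have c2 : ((2 : ℤ_[2]) : ℚ_[2]) = 2 := map_ofNat PadicInt.Coe.ringHom 2
  have c4 : ((4 : ℤ_[2]) : ℚ_[2]) = 4 := map_ofNat PadicInt.Coe.ringHom 4
  have c8 : ((8 : ℤ_[2]) : ℚ_[2]) = 8 := map_ofNat PadicInt.Coe.ringHom 8
  have c16 : ((16 : ℤ_[2]) : ℚ_[2]) = 16 := map_ofNat PadicInt.Coe.ringHom 16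
  have c32 : ((32 : ℤ_[2]) : ℚ_[2]) = 32 := map_ofNat PadicInt.Coe.ringHom 32
  ext <;> simp [WeierstrassCurve.quadraticTwist, WeierstrassCurve.map, WeierstrassCurve.b₂, WeierstrassCurve.b₄,
    WeierstrassCurve.b₆, c2, c4, c8, c16, c32] <;> ring

/-- Twist of the `II*`-form `[2α, 4p, 8γ, 16q, 32r]`: `[0, −(α² + 4p), 0, 8(αγ + 2q), −16(γ² + 2r)]`. [cite: SilvermanAEC2009, X.2 Prop. 2.4] -/
theorem quadraticTwist_negOne_map_of_IIstarForm (N : WeierstrassCurve ℤ_[2]) {α p γ q r : ℤ_[2]}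
    (h₁ : N.a₁ = 2 * α) (h₂ : N.a₂ = 4 * p) (h₃ : N.a₃ = 8 * γ) (h₄ : N.a₄ = 16 * q) (h₆ : N.a₆ = 32 * r) :
    (N.map (algebraMap ℤ_[2] ℚ_[2])).quadraticTwist (-1) =
      (⟨0, -(α ^ 2 + 4 * p), 0, 8 * (α * γ + 2 * q), -(16 * (γ ^ 2 + 2 * r))⟩ : WeierstrassCurve ℤ_[2]).map
        (algebraMap ℤ_[2] ℚ_[2]) := by
  obtain ⟨a₁, a₂, a₃, a₄, a₆⟩ := N
  simp only at h₁ h₂ h₃ h₄ h₆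
  subst h₁ h₂ h₃ h₄ h₆
  have c2 : ((2 : ℤ_[2]) : ℚ_[2]) = 2 := map_ofNat PadicInt.Coe.ringHom 2
  have c4 : ((4 : ℤ_[2]) : ℚ_[2]) = 4 := map_ofNat PadicInt.Coe.ringHom 4
  have c8 : ((8 : ℤ_[2]) : ℚ_[2]) = 8 := map_ofNat PadicInt.Coe.ringHom 8
  have c16 : ((16 : ℤ_[2]) : ℚ_[2]) = 16 := map_ofNat PadicInt.Coe.ringHom 16
  have c32 : ((32 : ℤ_[2]) : ℚ_[2]) = 32 := map_ofNat PadicInt.Coe.ringHom 32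
  ext <;> simp [WeierstrassCurve.quadraticTwist, WeierstrassCurve.map, WeierstrassCurve.b₂, WeierstrassCurve.b₄,
    WeierstrassCurve.b₆, c2, c4, c8, c16, c32] <;> ring

/-! ## §2 The global assembly: `f₂(W) = 3 ⟹ f₂(W ⊗ χ₋₄) = 4` -/

/-- **S-an-60, local form, IS A THEOREM — Barrios–Roy–Sahajpal–Tallana–Tobin–Wiersema 2025 Thm. 5.1, rows III / I₁* / III* / II*,
`d ≡ 3 (mod 4)`, kernel-checked for `d = −1`**: for an elliptic curve `W/ℚ` with `f₂(W) = 3` (additive, wild with Swan conductor `1`: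
Kodaira III/`ord Δ = 4`, I₁*/`8`, III*/`10` or II*/`11`) the `χ₋₄`-twist has `f₂(W ⊗ (−1)) = 4` (types II, I₀*, I₂*, I₃*, same `ord₂ Δ_min`).
[cite: BarriosEtAl2025, Thm. 5.1 (arXiv:2501.03209 pp. 15–16), rows III / I₁* / III* / II*] [cite: SilvermanATAEC1994, IV.9.4 and IV.11.1] -/
theorem conductorExponent_quadraticTwist_negOne_eq_four_of_eq_three (W : WeierstrassCurve ℚ) [W.IsElliptic]
    (hf : W.conductorExponent ((Rat.HeightOneSpectrum.primesEquiv (R := ℤ)).symm ⟨2, Nat.prime_two⟩) = 3) :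
    (W.quadraticTwist ((-1 : ℤ) : ℚ)).conductorExponent
        ((Rat.HeightOneSpectrum.primesEquiv (R := ℤ)).symm ⟨2, Nat.prime_two⟩) = 4 := by
  haveI : Fact (Nat.Prime 2) := ⟨Nat.prime_two⟩
  have hirr : Irreducible (2 : ℤ_[2]) := by exact_mod_cast PadicInt.irreducible_p (p := 2)
  have hϖirr : Irreducible (uniformizer ℤ_[2]) := irreducible_uniformizer
  have h2m : (2 : ℤ_[2]) ∈ maximalIdeal ℤ_[2] := (IsLocalRing.mem_maximalIdeal _).mpr hirr.not_isUnit
  have hm : ∀ {x : ℤ_[2]}, x ∈ maximalIdeal ℤ_[2] ↔ (2 : ℤ_[2]) ∣ x := fun {x} ↦ mem_maximalIdeal_iff_dvd_of_irreducible hirr x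
  have hmn : ∀ {x : ℤ_[2]} {n : ℕ}, x ∈ maximalIdeal ℤ_[2] ^ n ↔ (2 : ℤ_[2]) ^ n ∣ x := fun {x n} ↦
    mem_maximalIdeal_pow_iff_dvd_of_irreducible hirr x n
  set v : IsDedekindDomain.HeightOneSpectrum ℤ := (Rat.HeightOneSpectrum.primesEquiv (R := ℤ)).symm ⟨2, Nat.prime_two⟩
    with hvdef
  have hv : Rat.HeightOneSpectrum.natGenerator v = 2 :=
    congrArg Subtype.val ((Rat.HeightOneSpectrum.primesEquiv (R := ℤ)).apply_symm_apply ⟨2, Nat.prime_two⟩)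
  have e : Rat.HeightOneSpectrum.primesEquiv (R := ℤ) v = ⟨2, Nat.prime_two⟩ := Equiv.apply_symm_apply _ _
  -- the four types, `ord Δ_min`, read over `ℤ₂`
  have hK := kodairaSymbolAt_of_conductorExponent_eq_three_two W v hv hf
  have hKp := WeierstrassCurve.kodairaSymbolAt_eq_padic (R := ℤ) v W
  rw [e] at hKp
  change W.kodairaSymbolAt v = (((W.baseChange ℚ_[2]).minimal ℤ_[2]).integralModel ℤ_[2]).kodairaSymbolOfMinimal at hKp
  have hOp := WeierstrassCurve.ordMinimalDiscriminant_eq_padic (R := ℤ) v W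
  rw [e] at hOp
  change W.ordMinimalDiscriminant v =
    (IsDiscreteValuationRing.addVal ℤ_[2] (((W.baseChange ℚ_[2]).minimal ℤ_[2]).integralModel ℤ_[2]).Δ).toNat at hOp
  set X : WeierstrassCurve ℚ_[2] := W.baseChange ℚ_[2] with hX
  set V₀ : WeierstrassCurve ℤ_[2] := (X.minimal ℤ_[2]).integralModel ℤ_[2] with hV₀
  set E : VariableChange ℚ_[2] := (X.exists_isMinimal ℤ_[2]).choose with hE
  have hmin : X.minimal ℤ_[2] = E • X := rfl
  have hV₀X : V₀.baseChange ℚ_[2] = X.minimal ℤ_[2] := WeierstrassCurve.baseChange_integralModel_eq ℤ_[2] _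
  -- `Δ(V₀) ≠ 0`, and `ord Δ` of any `R`-model of `V₀`
  have hV₀Δ : V₀.Δ ≠ 0 := by
    intro h0
    have h1 : (V₀.baseChange ℚ_[2]).Δ = 0 := by
      rw [WeierstrassCurve.baseChange, WeierstrassCurve.map_Δ, h0, map_zero]
    rw [hV₀X, hmin] at h1
    exact (E • X).isUnit_Δ.ne_zero h1
  have hordD : ∀ D : VariableChange ℤ_[2], (addVal ℤ_[2] (D • V₀).Δ).toNat = W.ordMinimalDiscriminant v := fun D ↦ by
    rw [addVal_Δ_smul_toNat, ← hOp]
  have hΔD : ∀ D : VariableChange ℤ_[2], (D • V₀).Δ ≠ 0 := fun D ↦ by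
    rw [variableChange_Δ]; exact mul_ne_zero (pow_ne_zero 12 (Units.ne_zero _)) hV₀Δ
  -- the twist over `ℚ₂`
  have hd0 : ((-1 : ℤ) : ℚ) ≠ 0 := by norm_num
  haveI := W.isElliptic_quadraticTwist hd0
  set Xm : WeierstrassCurve ℚ_[2] := (W.quadraticTwist ((-1 : ℤ) : ℚ)).baseChange ℚ_[2] with hXm
  have hXmX : Xm = X.quadraticTwist (-1) := by
    rw [hXm, hX, WeierstrassCurve.baseChange, WeierstrassCurve.baseChange, WeierstrassCurve.map_quadraticTwist]
    simp
  -- `Δ(T) = Δ(D • V₀)` for a twist model `T` of the normal form `D • V₀`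
  have twistΔ : ∀ (D : VariableChange ℤ_[2]) (T : WeierstrassCurve ℤ_[2]),
      ((D • V₀).map (algebraMap ℤ_[2] ℚ_[2])).quadraticTwist (-1) = T.map (algebraMap ℤ_[2] ℚ_[2]) → T.Δ = (D • V₀).Δ := by
    intro D T hNT
    have h1 : (T.map (algebraMap ℤ_[2] ℚ_[2])).Δ = (((D • V₀).map (algebraMap ℤ_[2] ℚ_[2])).quadraticTwist (-1)).Δ := by
      rw [hNT]
    rw [WeierstrassCurve.map_Δ, WeierstrassCurve.quadraticTwist_Δ, WeierstrassCurve.map_Δ] at h1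
    norm_num at h1
    exact IsFractionRing.injective ℤ_[2] ℚ_[2] h1
  -- common step: from a normal form `D • V₀`, a twist model `T` and an exit change `C₆` to the conductor exponent
  have key : ∀ (D : VariableChange ℤ_[2]) (T : WeierstrassCurve ℤ_[2]) (C₆ : VariableChange ℤ_[2]),
      ((D • V₀).map (algebraMap ℤ_[2] ℚ_[2])).quadraticTwist (-1) = T.map (algebraMap ℤ_[2] ℚ_[2]) →
      (C₆ • T).kodairaSymbolOfMinimal ≠ .I 0 →
      (W.quadraticTwist ((-1 : ℤ) : ℚ)).conductorExponent v =
        W.ordMinimalDiscriminant v + 1 - (C₆ • T).kodairaSymbolOfMinimal.numComponents := by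
    intro D T C₆ hNT hne
    set Ctot : VariableChange ℚ_[2] := D.map (algebraMap ℤ_[2] ℚ_[2]) * E with hCtot
    have hCX : Ctot • X = (D • V₀).map (algebraMap ℤ_[2] ℚ_[2]) := by
      rw [hCtot, mul_smul, ← hmin, ← hV₀X]
      exact WeierstrassCurve.map_variableChange _ _ _
    set C₁ : VariableChange ℚ_[2] := ⟨Ctot.u, (-1) * Ctot.r, 0, 0⟩ with hC₁
    have hT : T.map (algebraMap ℤ_[2] ℚ_[2]) = C₁ • Xm := by
      rw [← hNT, ← hCX, WeierstrassCurve.quadraticTwist_smul, hXmX]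
    have hT' : (C₆ • T).map (algebraMap ℤ_[2] ℚ_[2]) = (C₆.map (algebraMap ℤ_[2] ℚ_[2]) * C₁) • Xm := by
      rw [mul_smul, ← hT]
      exact (WeierstrassCurve.map_variableChange _ _ _).symm
    rw [conductorExponent_negTwist_of_exitModel W (C₆ • T) _ hT' hne, addVal_Δ_smul_toNat, twistΔ D T hNT, hordD D]
  rcases hK with ⟨hT3, hord⟩ | ⟨hT1, hord⟩ | ⟨hT3s, hord⟩ | ⟨hT2s, hord⟩
  · -- Kodaira III, `ord Δ = 4`: the twist is of type II
    rw [hT3] at hKp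
    obtain ⟨D, h1m, h2m', h3m, h4m, h4n, h6m⟩ := LocalIndex.exists_smul_of_kodairaSymbolOfMinimal_eq_III V₀ hKp.symm
    obtain ⟨α, hα⟩ := hm.mp h1m
    obtain ⟨β, hβ⟩ := hm.mp h2m'
    obtain ⟨γ, hγ⟩ := hm.mp h3m
    obtain ⟨q, hq⟩ := hm.mp h4m
    obtain ⟨r₁, hr₁⟩ := hmn.mp h6m
    have hqu : IsUnit q := by
      rw [isUnit_iff_not_dvd hirr]
      rintro ⟨q', hq'⟩
      exact h4n (hmn.mpr ⟨q', by rw [hq, hq']; ring⟩)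
    have h8 : ¬ (2 : ℤ_[2]) ^ 3 ∣ (D • V₀).b₈ := by
      rintro ⟨c, hc⟩
      rw [WeierstrassCurve.b₈, hα, hβ, hγ, hq, hr₁] at hc
      have h4q : (4 : ℤ_[2]) * q ^ 2 = 4 * (2 * (2 * α ^ 2 * r₁ + 4 * β * r₁ - α * γ * q + β * γ ^ 2 - c)) := by
        linear_combination -hc
      have hq2 : q ^ 2 = 2 * (2 * α ^ 2 * r₁ + 4 * β * r₁ - α * γ * q + β * γ ^ 2 - c) :=
        mul_left_cancel₀ (by norm_num : (4 : ℤ_[2]) ≠ 0) h4q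
      exact (isUnit_iff_not_dvd hirr _).mp (hqu.pow 2) ⟨_, hq2⟩
    have hγu : IsUnit γ := by
      by_contra hγu
      obtain ⟨-, -, h6, h8', h9⟩ := addVal_Δ_toNat_of_step4 hirr (D • V₀) hα hγ hq hr₁ h8
      have hn := hordD D
      rw [hord] at hn
      obtain ⟨γ₁, hγ₁⟩ := (not_isUnit_iff_dvd hirr _).mp hγu
      by_cases hB : IsUnit (α ^ 2 + (D • V₀).a₂)
      · have := h6 γ₁ hγ₁ hB; omega
      obtain ⟨β', hβ'⟩ := (not_isUnit_iff_dvd hirr _).mp hB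
      have ha₂ : (D • V₀).a₂ = 2 * β' - α ^ 2 := by linear_combination hβ'
      by_cases hT : IsUnit (β' * q + γ₁ ^ 2 + r₁)
      · have := h8' γ₁ β' hγ₁ ha₂ hT; omega
      · have := h9 γ₁ β' hγ₁ ha₂ hT; omega
    have h6' : (D • V₀).a₆ = 4 * r₁ := by rw [hr₁]; ring
    have hNT := quadraticTwist_negOne_map_of_IIIForm (D • V₀) hα hβ hγ hq h6'
    have hexit := kodairaSymbolOfMinimal_negTwist_toII (-(α ^ 2 + 2 * β)) (q + α * γ) γ r₁ hγu
    rw [key D _ ⟨1, 0, 0, 1⟩ hNT (by rw [hexit]; decide), hexit, hord]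
    rfl
  · -- Kodaira I₁*, `ord Δ = 8`: the twist is of type I₀*
    rw [hT1] at hKp
    obtain ⟨D, h1m, h2m', -, h3m, h4m, h6m⟩ := exists_smul_of_kodairaSymbolOfMinimal_eq_Istar_succ V₀ hKp.symm
    obtain ⟨α, hα⟩ := hm.mp h1m
    obtain ⟨β, hβ⟩ := hm.mp h2m'
    obtain ⟨γ', hγ'⟩ := hmn.mp h3m
    obtain ⟨q', hq'⟩ := hmn.mp h4m
    obtain ⟨r', hr'⟩ := hmn.mp h6m
    have hγ : (D • V₀).a₃ = 4 * γ' := by rw [hγ']; ring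
    have hq : (D • V₀).a₄ = 8 * q' := by rw [hq']; ring
    have hr : (D • V₀).a₆ = 16 * r' := by rw [hr']; ring
    have hγu : IsUnit γ' := by
      by_contra hγu
      obtain ⟨γ₁, hγ₁⟩ := (not_isUnit_iff_dvd hirr _).mp hγu
      have h3' : (D • V₀).a₃ ∈ maximalIdeal ℤ_[2] ^ 3 := hmn.mpr ⟨γ₁, by rw [hγ, hγ₁]; ring⟩
      have h10 : (D • V₀).Δ ∈ maximalIdeal ℤ_[2] ^ 10 :=
        Δ_mem_pow_of_a_of_two_mem (D • V₀) h2m 2 4 6 6 (n₁ := 1) (n₂ := 1) (by rw [pow_one]; exact h1m)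
          (by rw [pow_one]; exact h2m') h3' h4m h6m
      have := le_addVal_toNat_of_pow_dvd hϖirr (hΔD D) (mem_maximalIdeal_pow_iff_dvd.mp h10)
      rw [hordD D, hord] at this
      omega
    have hNT := quadraticTwist_negOne_map_of_IstarOneForm (D • V₀) hα hβ hγ hq hr
    have hexit := kodairaSymbolOfMinimal_negTwist_toIstarZero α β γ' q' r' hγu
    rw [key D _ ⟨1, 0, α, 2⟩ hNT (by rw [hexit]; decide), hexit, hord]
    rfl
  · -- Kodaira III*, `ord Δ = 10`: the twist is of type I₂*
    rw [hT3s] at hKp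
    obtain ⟨D, h1m, h2m', h3m, h4m, h4n, h6m⟩ := LocalIndex.exists_smul_of_kodairaSymbolOfMinimal_eq_IIIstar V₀ hKp.symm
    obtain ⟨α, hα⟩ := hm.mp h1m
    obtain ⟨p', hp'⟩ := hmn.mp h2m'
    obtain ⟨γ', hγ'⟩ := hmn.mp h3m
    obtain ⟨q', hq'⟩ := hmn.mp h4m
    obtain ⟨r', hr'⟩ := hmn.mp h6m
    have hqu : IsUnit q' := by
      rw [isUnit_iff_not_dvd hirr]
      rintro ⟨q'', hq''⟩
      exact h4n (hmn.mpr ⟨q'', by rw [hq', hq'']; ring⟩)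
    have hαu : IsUnit α := by
      by_contra hαu
      obtain ⟨-, h12, h14, h15⟩ := addVal_Δ_toNat_of_step9 hirr (D • V₀) hα hp' hγ' hq' hr' hqu
      have hn := hordD D
      rw [hord] at hn
      obtain ⟨α₁, hα₁⟩ := (not_isUnit_iff_dvd hirr _).mp hαu
      by_cases hγu : IsUnit γ'
      · have := h12 α₁ hα₁ hγu; omega
      obtain ⟨γ₁, hγ₁⟩ := (not_isUnit_iff_dvd hirr _).mp hγu
      by_cases hT : IsUnit (r' + (α₁ ^ 2 + p') * q')
      · have := h14 α₁ γ₁ hα₁ hγ₁ hT; omega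
      · have := h15 α₁ γ₁ hα₁ hγ₁ hT; omega
    have hp : (D • V₀).a₂ = 4 * p' := by rw [hp']; ring
    have hγ : (D • V₀).a₃ = 8 * γ' := by rw [hγ']; ring
    have hq : (D • V₀).a₄ = 8 * q' := by rw [hq']; ring
    have hr : (D • V₀).a₆ = 32 * r' := by rw [hr']; ring
    have hNT := quadraticTwist_negOne_map_of_IIIstarForm (D • V₀) hα hp hγ hq hr
    have hTΔ := twistΔ D _ hNT
    have hexit := kodairaSymbolOfMinimal_negTwist_toIstarTwo α p' γ' q' r' hαu hqu
      (by rw [Δ_smul_of_u_eq_one rfl, hTΔ]; exact hΔD D)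
    rw [key D _ ⟨1, 0, α, 0⟩ hNT (by rw [hexit]; decide), hexit, hord]
    rfl
  · -- Kodaira II*, `ord Δ = 11`: the twist is of type I₃*
    rw [hT2s] at hKp
    obtain ⟨D, h1m, h2m', h3m, h4m, h6m, h6n⟩ := LocalIndex.exists_smul_of_kodairaSymbolOfMinimal_eq_IIstar V₀ hKp.symm
    obtain ⟨α, hα⟩ := hm.mp h1m
    obtain ⟨p', hp'⟩ := hmn.mp h2m'
    obtain ⟨γ', hγ'⟩ := hmn.mp h3m
    obtain ⟨q', hq'⟩ := hmn.mp h4m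
    obtain ⟨r', hr'⟩ := hmn.mp h6m
    have hru : IsUnit r' := by
      rw [isUnit_iff_not_dvd hirr]
      rintro ⟨r'', hr''⟩
      exact h6n (hmn.mpr ⟨r'', by rw [hr', hr'']; ring⟩)
    have hαu : IsUnit α := by
      by_contra hαu
      obtain ⟨-, h12, h14⟩ := addVal_Δ_toNat_of_step10 hirr (D • V₀) hα hp' hγ' hq' hr' hru
      have hn := hordD D
      rw [hord] at hn
      obtain ⟨α₁, hα₁⟩ := (not_isUnit_iff_dvd hirr _).mp hαu
      by_cases hγu : IsUnit γ'
      · have := h12 α₁ hα₁ hγu; omega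
      obtain ⟨γ₁, hγ₁⟩ := (not_isUnit_iff_dvd hirr _).mp hγu
      have := h14 α₁ γ₁ hα₁ hγ₁; omega
    have hp : (D • V₀).a₂ = 4 * p' := by rw [hp']; ring
    have hγ : (D • V₀).a₃ = 8 * γ' := by rw [hγ']; ring
    have hq : (D • V₀).a₄ = 16 * q' := by rw [hq']; ring
    have hr : (D • V₀).a₆ = 32 * r' := by rw [hr']; ring
    have hNT := quadraticTwist_negOne_map_of_IIstarForm (D • V₀) hα hp hγ hq hr
    have hTΔ := twistΔ D _ hNT
    have hexit := kodairaSymbolOfMinimal_negTwist_toIstarThree α p' γ' q' r' hαu hru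
      (by rw [Δ_smul_of_u_eq_one rfl, hTΔ]; exact hΔD D)
    rw [key D _ ⟨1, 0, α, 0⟩ hNT (by rw [hexit]; decide), hexit, hord]
    rfl

/-- **S-an-60 at any place `v` of `ℤ` above `2`.** [cite: BarriosEtAl2025, Thm. 5.1, rows III / I₁* / III* / II*] -/
theorem conductorExponent_quadraticTwist_negOne_eq_four_of_eq_three' (W : WeierstrassCurve ℚ) [W.IsElliptic]
    (v : IsDedekindDomain.HeightOneSpectrum ℤ) (hv : Rat.HeightOneSpectrum.natGenerator v = 2)
    (hf : W.conductorExponent v = 3) :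
    (W.quadraticTwist ((-1 : ℤ) : ℚ)).conductorExponent v = 4 := by
  have hpv : Rat.HeightOneSpectrum.primesEquiv (R := ℤ) v = ⟨2, Nat.prime_two⟩ := Subtype.ext hv
  have hvv : v = (Rat.HeightOneSpectrum.primesEquiv (R := ℤ)).symm ⟨2, Nat.prime_two⟩ := by
    rw [← hpv, Equiv.symm_apply_apply]
  subst hvv
  exact conductorExponent_quadraticTwist_negOne_eq_four_of_eq_three W hf

end Summit.BirchSwinnertonDyer.BirchSwinnertonDyer.Theorems.ManinLocalTwoThree

end
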